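import Mathlib
import HarnessLib
import Summits.NavierStokesRegularity.NavierStokesRegularity.Theses.QuarterLogPincer
import Summits.NavierStokesRegularity.NavierStokesRegularity.Theorems.QuarterLogPincerThinCascadeDefs
import Summits.NavierStokesRegularity.NavierStokesRegularity.Theorems.QuarterLogPincerTruncationEdgeDefs
import Summits.NavierStokesRegularity.NavierStokesRegularity.Theorems.QuarterLogPincerTruncationEdgeAnatomyDefs
import Summits.NavierStokesRegularity.NavierStokesRegularity.Theorems.QuarterLogPincerQuietCollarDefs
import Summits.NavierStokesRegularity.NavierStokesRegularity.Theorems.QuarterLogPincerQuietCoreDefs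
import Summits.NavierStokesRegularity.NavierStokesRegularity.Theorems.QuarterLogPincerQuietCoreSubcriticalUpgrade
import Summits.NavierStokesRegularity.NavierStokesRegularity.Theorems.TypeIQuantSubcubicExp.Negative.QuietCoreEnvelopeLoud
import Literature.Analysis.FluidPDE.TypeIAncientMild

/-!
# Route `QuarterLogPincer`, crux `TypeIQuantSubcubicExp` (stmt-NavierStokesRegularity-24077), line `quiet_core` —
# §2/§5 DE-FLICKERING BY NAME: Q3♭ from the landed `quietCore_all`, and the value of the crux modulo the EDGE

Port BY NAME (bodies BYTE-IDENTICAL) of the de-flickering section of ns-idea-7's workfile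
`Cruxes/TypeIQuantSubcubicExp/Lines/quiet_core.lean` (v1.9, §2 and the def-free part of §5), over the landed quiet-core
objects (`…QuietCoreDefs`, p687472) and the landed UNCONDITIONAL quiet-core propagation `quietCore_all`
(`…QuietCoreSubcriticalUpgrade`, p690761, typer g36):

* (`not_singularAt_of_bound` is NOT re-landed: it is the tree's
  `…Theorems.TypeIQuantSubcubicExp.Negative.not_singularAt_zero_of_bound` (`QuietCoreEnvelopeLoud`, dedup), cited in
  its place — the only byte change in the ported bodies;)
* `localRateFloor_of_singularAt` (mod QC) / ★ `localRateFloor_of_singularAt'` (UNCONDITIONAL) — **Q3♭**: in the log-cube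
  class an apex singularity carries a unit-ball rate floor (what the loop `quiet_collar` consumes from its Q3);
* `logCubeLiouville_of_logCubeFloorLiouville` (mod QC) / `…'` (unconditional) — the floor-Liouville value implies the
  apex-Liouville value;
* `logCubeLiouville_of_edge : (24077 → LogCubeFloorLiouville) → 24077 → LogCubeLiouville` — the value of the crux,
  de-flickered, modulo the EDGE of `quiet_collar` (supplied by name in `…QuietCollarEdgeLog`).

The `def`s of §2/§3 (`LocalRateFloorLogCube`, `StubLogCubeExtractionFlat`) and their one-line corollaries are NOT ported
here (definitions do not live in proof files).  HONEST FRAME: statements about HYPOTHETICAL Type-I ancient mild fields with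
a log-shaped cube budget; nothing here bears on 24077's truth, W7 or Navier–Stokes regularity (OPEN / not proved).
pub-ns-dss typer (g37), `--supports stmt-NavierStokesRegularity-24077`; bodies by ns-idea-7 (g10–g12).
-/

noncomputable section

set_option linter.dupNamespace false

namespace Summit.NavierStokesRegularity.NavierStokesRegularity.Cruxes.TypeIQuantSubcubicExp.QuietCore

open MeasureTheory Set Function Metric Filter Topology
open scoped ENNReal NNReal
open Literature.Analysis Literature.Analysis.FluidPDE
open Summit.NavierStokesRegularity.NavierStokesRegularity.Cruxes.TypeIQuantSubcubicExp.ThinCascade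
  (TaoFrame ThinObject SingularAt)
open Summit.NavierStokesRegularity.NavierStokesRegularity.Cruxes.TypeIQuantSubcubicExp.TruncationEdge
  (EnvelopeCubeBudget)
open Summit.NavierStokesRegularity.NavierStokesRegularity.Cruxes.TypeIQuantSubcubicExp.QuietCollar
  (LocalRateFloor LogCubeLiouville LogCubeFloorLiouville)
open Summit.NavierStokesRegularity.NavierStokesRegularity.Theorems.TypeIQuantSubcubicExp.Negative
  (not_singularAt_zero_of_bound)

/-! ### §2 De-flickering: Q3♭ from QC (author's, verbatim up to the cited `not_singularAt_zero_of_bound`) -/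

/-- **Q3♭ from QC.**  In the log-cube class an apex singularity carries a unit-ball rate floor: otherwise there are
arbitrarily late `c₀`-quiet slices, QC bounds the core up to the apex, and the apex is regular. -/
theorem localRateFloor_of_singularAt (hQC : StubQuietCore) {M : ℝ}
    {v : ℝ → EuclideanSpace ℝ (Fin 3) → EuclideanSpace ℝ (Fin 3)}
    (hv : IsTypeIAncientMild M v) (hB : EnvelopeCubeBudget v) (hsing : SingularAt v 0) :
    LocalRateFloor v := by
  obtain ⟨B, hBv⟩ := (envelopeCubeBudget_iff v).1 hB
  obtain ⟨c₀, s₁, K, hc₀, hs₁, -, hcore⟩ := hQC M B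
  by_contra hfl
  -- no floor at level `c₀` from `s₁` on: a quiet slice exists
  have hquiet : ∃ s ∈ Set.Ico s₁ 0,
      ∀ x ∈ Metric.ball (0 : EuclideanSpace ℝ (Fin 3)) 1, ‖v s x‖ ≤ c₀ / Real.sqrt (-s) := by
    by_contra hne
    push Not at hne
    exact hfl ⟨c₀, s₁, hc₀, hs₁, fun s hs => by
      obtain ⟨x, hx, hlt⟩ := hne s hs
      exact ⟨x, hx, hlt.le⟩⟩
  obtain ⟨s, hs, hq⟩ := hquiet
  exact not_singularAt_zero_of_bound hs.2 (hcore v hv hBv s hs hq) hsing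

/-- The floor-Liouville value implies the apex-Liouville value (mod QC). -/
theorem logCubeLiouville_of_logCubeFloorLiouville (hQC : StubQuietCore) (hL : LogCubeFloorLiouville) :
    LogCubeLiouville :=
  fun M v hv hB hs => hL M v hv hB (localRateFloor_of_singularAt hQC hv hB hs)

/-! ### §5 Unconditional corollaries: QC discharged by `quietCore_all` (author's, verbatim) -/

/-- g9's Q3, restricted to the log-cube class, as a function (unconditional). -/
theorem localRateFloor_of_singularAt' {M : ℝ} {v : ℝ → EuclideanSpace ℝ (Fin 3) → EuclideanSpace ℝ (Fin 3)}
    (hv : IsTypeIAncientMild M v) (hB : EnvelopeCubeBudget v) (hsing : SingularAt v 0) : LocalRateFloor v :=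
  localRateFloor_of_singularAt quietCore_all hv hB hsing

/-- **The two Liouville values coincide (unconditional):** `LogCubeFloorLiouville → LogCubeLiouville`
(the converse `LogCubeLiouville → LogCubeFloorLiouville` is trivial only after translation plumbing, see header). -/
theorem logCubeLiouville_of_logCubeFloorLiouville' (hL : LogCubeFloorLiouville) : LogCubeLiouville :=
  logCubeLiouville_of_logCubeFloorLiouville quietCore_all hL

/-- **Value of the crux, de-flickered (mod g9's EDGE theorem only):** given the edge `crux → LogCubeFloorLiouville`
(kernel-checked in `Lines/quiet_collar.lean` modulo QP2; enters BY STATEMENT), the crux implies the apex-Liouville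
value `LogCubeLiouville` with NO floor/flicker hypothesis. -/
theorem logCubeLiouville_of_edge
    (hEdge : Summit.NavierStokesRegularity.NavierStokesRegularity.Theses.QuarterLogPincer.TypeIQuantSubcubicExp →
      LogCubeFloorLiouville)
    (h : Summit.NavierStokesRegularity.NavierStokesRegularity.Theses.QuarterLogPincer.TypeIQuantSubcubicExp) :
    LogCubeLiouville :=
  logCubeLiouville_of_logCubeFloorLiouville' (hEdge h)

end Summit.NavierStokesRegularity.NavierStokesRegularity.Cruxes.TypeIQuantSubcubicExp.QuietCore

end
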